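import Literature.AnabelianGeometry.AbsoluteAnabelian.AutHolomorphicSpacesDiscPictureRCProofs
import Literature.Analysis.Complex.UnitDiscIsometries
import Literature.Analysis.Complex.UnitDiscAutGenerators
import Mathlib.Topology.CompactOpen
import HarnessLib

/-!
# The RC-holomorphic automorphism group of an Aut-holomorphic disc: lemmas (PROOF-ONLY, Prop. 2.2 (ii))

For a Riemann surface `Y` with a biholomorphic `e : Y ≃ₜ unitDiscOpens` we characterise the
self-homeomorphisms `ψ` of `Y` that are RC-holomorphic in both directions as those whose disc
picture (see `AutHolomorphicSpacesDiscPictureProofs`) preserves `discCosh = cosh ρ`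
(`discCosh_pic_iff_isRCHolomorphic`), prove that this condition is closed in the compact-open
topology (`isClosed_setOf_discCosh_pic`), that squares of such `ψ` are biholomorphic, and that every
biholomorphic `ψ` is a product of three biholomorphic self-homeomorphisms each of which is
infinitely divisible among biholomorphic self-homeomorphisms (rotations and half-turns,
`UnitDiscAutGenerators`).  [AbsTopIII] Prop. 2.2 (ii) is assembled from these in
`AutHolomorphicSpacesRCGroupProofs`.

[cite: MochizukiAbsTopIII2015, Proposition 2.2 (ii) p.52]
-/

noncomputable section

namespace Literature.AnabelianGeometry.AbsoluteAnabelian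

open _root_.TopologicalSpace _root_.Topology _root_.Set _root_.Metric _root_.Function _root_.Filter
open scoped _root_.Manifold _root_.ContDiff ComplexConjugate
open Literature.Analysis.Complex

/-! ### Continuity and closedness -/

section Closed

variable {Y : Type} [TopologicalSpace Y]

/-- Evaluation of the disc picture at a point of the ball is continuous in the compact-open
topology. [cite: MochizukiAbsTopIII2015, Proposition 2.2 (ii) p.52] -/
theorem continuous_pic_apply (e : Y ≃ₜ unitDiscOpens) {z : ℂ} (hz : z ∈ ball (0 : ℂ) 1) :
    letI := homeoCompactOpen Y
    Continuous fun ψ : Y ≃ₜ Y =>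
      Function.extend Subtype.val (Subtype.val ∘ (e.symm.trans (ψ.trans e))) (fun _ => (0 : ℂ)) z := by
  letI := homeoCompactOpen Y
  have hfun : (fun ψ : Y ≃ₜ Y =>
      Function.extend Subtype.val (Subtype.val ∘ (e.symm.trans (ψ.trans e))) (fun _ => (0 : ℂ)) z) =
      fun ψ : Y ≃ₜ Y => ((e ((ψ : C(Y, Y)) (e.symm ⟨z, hz⟩))) : ℂ) := by
    funext ψ
    rw [pic_apply_of_mem e ψ hz]
    rfl
  rw [hfun]
  have h1 : Continuous fun ψ : Y ≃ₜ Y => (ψ : C(Y, Y)) (e.symm ⟨z, hz⟩) :=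
    (ContinuousEvalConst.continuous_eval_const (F := C(Y, Y)) (e.symm ⟨z, hz⟩)).comp
      continuous_induced_dom
  exact continuous_subtype_val.comp (e.continuous.comp h1)

/-- `discCosh` is continuous on `ball × ball`. [cite: Beardon1983, Thm. 7.2.1] -/
theorem continuousOn_discCosh :
    ContinuousOn (fun p : ℂ × ℂ => discCosh p.1 p.2) (ball (0 : ℂ) 1 ×ˢ ball (0 : ℂ) 1) := by
  have hden : ∀ p ∈ ball (0 : ℂ) 1 ×ˢ ball (0 : ℂ) 1, (1 - ‖p.1‖ ^ 2) * (1 - ‖p.2‖ ^ 2) ≠ 0 := by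
    rintro ⟨z, w⟩ ⟨hz, hw⟩
    have hz' : ‖z‖ < 1 := mem_ball_zero_iff.1 hz
    have hw' : ‖w‖ < 1 := mem_ball_zero_iff.1 hw
    have h1 : 0 < 1 - ‖z‖ ^ 2 := by nlinarith [norm_nonneg z]
    have h2 : 0 < 1 - ‖w‖ ^ 2 := by nlinarith [norm_nonneg w]
    exact (mul_pos h1 h2).ne'
  unfold discCosh
  refine continuousOn_const.add (ContinuousOn.div ?_ ?_ hden)
  · fun_prop
  · fun_prop

/-- **The `discCosh`-isometry condition on pictures is closed** in the compact-open topology on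
`Y ≃ₜ Y`. [cite: MochizukiAbsTopIII2015, Proposition 2.2 (ii) p.52] -/
theorem isClosed_setOf_discCosh_pic (e : Y ≃ₜ unitDiscOpens) :
    letI := homeoCompactOpen Y
    IsClosed {ψ : Y ≃ₜ Y | ∀ z ∈ ball (0 : ℂ) 1, ∀ w ∈ ball (0 : ℂ) 1,
      discCosh (Function.extend Subtype.val (Subtype.val ∘ (e.symm.trans (ψ.trans e))) (fun _ => (0 : ℂ)) z)
        (Function.extend Subtype.val (Subtype.val ∘ (e.symm.trans (ψ.trans e))) (fun _ => (0 : ℂ)) w) =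
      discCosh z w} := by
  letI := homeoCompactOpen Y
  simp only [Set.setOf_forall]
  refine isClosed_iInter fun z => isClosed_iInter fun hz => isClosed_iInter fun w =>
    isClosed_iInter fun hw => ?_
  have h2 : Continuous fun ψ : Y ≃ₜ Y =>
      (Function.extend Subtype.val (Subtype.val ∘ (e.symm.trans (ψ.trans e))) (fun _ => (0 : ℂ)) z,
        Function.extend Subtype.val (Subtype.val ∘ (e.symm.trans (ψ.trans e))) (fun _ => (0 : ℂ)) w) :=
    (continuous_pic_apply e hz).prodMk (continuous_pic_apply e hw)
  have h3 : ∀ ψ : Y ≃ₜ Y,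
      (Function.extend Subtype.val (Subtype.val ∘ (e.symm.trans (ψ.trans e))) (fun _ => (0 : ℂ)) z,
        Function.extend Subtype.val (Subtype.val ∘ (e.symm.trans (ψ.trans e))) (fun _ => (0 : ℂ)) w) ∈
        ball (0 : ℂ) 1 ×ˢ ball (0 : ℂ) 1 := fun ψ =>
    Set.mk_mem_prod (mapsTo_extend _ hz) (mapsTo_extend _ hw)
  have hc := continuousOn_discCosh.comp_continuous h2 h3
  simp only [Function.comp_def] at hc
  exact isClosed_eq hc continuous_const

/-- **The reflection**: a self-homeomorphism of `Y` whose picture is complex conjugation.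
[cite: MochizukiAbsTopIII2015, Proposition 2.2 (ii) p.52] -/
theorem exists_homeomorph_pic_conj (e : Y ≃ₜ unitDiscOpens) :
    ∃ κ : Y ≃ₜ Y, EqOn (Function.extend Subtype.val (Subtype.val ∘ (e.symm.trans (κ.trans e)))
      (fun _ => (0 : ℂ))) (fun z => conj z) (ball 0 1) := by
  let C : unitDiscOpens ≃ₜ unitDiscOpens :=
    { toFun := fun x => ⟨conj (x : ℂ), conj_mem_unitBall x.2⟩
      invFun := fun x => ⟨conj (x : ℂ), conj_mem_unitBall x.2⟩
      left_inv := fun x => Subtype.ext (by simp)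
      right_inv := fun x => Subtype.ext (by simp)
      continuous_toFun := by
        exact (Complex.continuous_conj.comp continuous_subtype_val).subtype_mk _
      continuous_invFun := by
        exact (Complex.continuous_conj.comp continuous_subtype_val).subtype_mk _ }
  refine ⟨e.trans (C.trans e.symm), fun z hz => ?_⟩
  rw [pic_apply_of_mem e _ hz]
  simp [C]

end Closed

/-! ### Isometry pictures versus RC-holomorphy -/

section RC

variable {Y : Type} [TopologicalSpace Y] [ChartedSpace ℂ Y]

/-- **Isometry picture ⇒ of Möbius or anti-Möbius type**, recorded with the consequences used
below: in the Möbius case `ψ` is biholomorphic. [cite: MochizukiAbsTopIII2015, Proposition 2.2 (ii) p.52] -/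
theorem mdifferentiable_or_conj_of_discCosh_pic (e : Y ≃ₜ unitDiscOpens)
    (he : MDifferentiable 𝓘(ℂ, ℂ) 𝓘(ℂ, ℂ) e) (hes : MDifferentiable 𝓘(ℂ, ℂ) 𝓘(ℂ, ℂ) e.symm) {ψ : Y ≃ₜ Y}
    (hiso : ∀ z ∈ ball (0 : ℂ) 1, ∀ w ∈ ball (0 : ℂ) 1,
      discCosh (Function.extend Subtype.val (Subtype.val ∘ (e.symm.trans (ψ.trans e))) (fun _ => (0 : ℂ)) z)
        (Function.extend Subtype.val (Subtype.val ∘ (e.symm.trans (ψ.trans e))) (fun _ => (0 : ℂ)) w) =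
      discCosh z w) :
    (MDifferentiable 𝓘(ℂ, ℂ) 𝓘(ℂ, ℂ) ψ ∧ MDifferentiable 𝓘(ℂ, ℂ) 𝓘(ℂ, ℂ) ψ.symm) ∨
      ∃ c a : ℂ, ‖c‖ = 1 ∧ ‖a‖ < 1 ∧
        EqOn (Function.extend Subtype.val (Subtype.val ∘ (e.symm.trans (ψ.trans e))) (fun _ => (0 : ℂ)))
          (fun z => discRot c a (conj z)) (ball 0 1) := by
  have hc : ContinuousOn (Function.extend Subtype.val (Subtype.val ∘ (e.symm.trans (ψ.trans e)))
      (fun _ => (0 : ℂ))) (ball 0 1) := continuousOn_extend (e.symm.trans (ψ.trans e)).continuous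
  obtain ⟨c, a, hca, ha, h⟩ := exists_eq_discRot_or_conj_of_discCosh_eq hc (mapsTo_extend _) hiso
  rcases h with h | h
  · exact Or.inl (mdifferentiable_of_pic_eqOn_discRot e he hes hca ha h)
  · exact Or.inr ⟨c, a, hca, ha, h⟩

/-- **Squares of RC-holomorphic automorphisms are biholomorphic**: if the picture of `ψ` preserves
`discCosh`, then `ψ * ψ` is biholomorphic. [cite: MochizukiAbsTopIII2015, Proposition 2.2 (ii) p.52] -/
theorem mdifferentiable_mul_self_of_discCosh_pic (e : Y ≃ₜ unitDiscOpens)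
    (he : MDifferentiable 𝓘(ℂ, ℂ) 𝓘(ℂ, ℂ) e) (hes : MDifferentiable 𝓘(ℂ, ℂ) 𝓘(ℂ, ℂ) e.symm) {ψ : Y ≃ₜ Y}
    (hiso : ∀ z ∈ ball (0 : ℂ) 1, ∀ w ∈ ball (0 : ℂ) 1,
      discCosh (Function.extend Subtype.val (Subtype.val ∘ (e.symm.trans (ψ.trans e))) (fun _ => (0 : ℂ)) z)
        (Function.extend Subtype.val (Subtype.val ∘ (e.symm.trans (ψ.trans e))) (fun _ => (0 : ℂ)) w) =
      discCosh z w) :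
    MDifferentiable 𝓘(ℂ, ℂ) 𝓘(ℂ, ℂ) (ψ * ψ) ∧ MDifferentiable 𝓘(ℂ, ℂ) 𝓘(ℂ, ℂ) (ψ * ψ).symm := by
  rcases mdifferentiable_or_conj_of_discCosh_pic e he hes hiso with ⟨h1, h2⟩ | ⟨c, a, hca, ha, h⟩
  · exact ⟨h1.comp h1, h2.comp h2⟩
  · obtain ⟨g, hg, hgg⟩ := isDiscAut_discRot_conj_sq hca ha
    obtain ⟨c', a', hc', ha', -, hge⟩ := hg.exists_eq_discRot
    refine mdifferentiable_of_pic_eqOn_discRot e he hes hc' ha' fun z hz => ?_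
    have hz' : discRot c a (conj z) ∈ ball (0 : ℂ) 1 :=
      (isDiscAut_discRot hca ha).mapsTo (conj_mem_unitBall hz)
    have e1 := h hz
    have e2 := h hz'
    have e3 := hgg hz
    simp only [comp_apply] at e1 e2 e3
    rw [pic_mul e ψ ψ hz, e1, e2, e3, hge hz]

variable [IsManifold 𝓘(ℂ, ℂ) ω Y]

/-- **Isometry picture ⇒ RC-holomorphic** (Beardon 7.4.1 + the picture dictionary).
[cite: MochizukiAbsTopIII2015, Proposition 2.2 (ii) p.52] -/
theorem isRCHolomorphic_of_discCosh_pic (e : Y ≃ₜ unitDiscOpens)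
    (he : MDifferentiable 𝓘(ℂ, ℂ) 𝓘(ℂ, ℂ) e) (hes : MDifferentiable 𝓘(ℂ, ℂ) 𝓘(ℂ, ℂ) e.symm) {ψ : Y ≃ₜ Y}
    (hiso : ∀ z ∈ ball (0 : ℂ) 1, ∀ w ∈ ball (0 : ℂ) 1,
      discCosh (Function.extend Subtype.val (Subtype.val ∘ (e.symm.trans (ψ.trans e))) (fun _ => (0 : ℂ)) z)
        (Function.extend Subtype.val (Subtype.val ∘ (e.symm.trans (ψ.trans e))) (fun _ => (0 : ℂ)) w) =
      discCosh z w) : IsRCHolomorphic (⇑ψ) := by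
  have hc : ContinuousOn (Function.extend Subtype.val (Subtype.val ∘ (e.symm.trans (ψ.trans e)))
      (fun _ => (0 : ℂ))) (ball 0 1) := continuousOn_extend (e.symm.trans (ψ.trans e)).continuous
  obtain ⟨c, a, hca, ha, h⟩ := exists_eq_discRot_or_conj_of_discCosh_eq hc (mapsTo_extend _) hiso
  rcases h with h | h
  · obtain ⟨h1, -⟩ := mdifferentiable_of_pic_eqOn_discRot e he hes hca ha h
    exact fun p => Or.inl (Filter.Eventually.of_forall fun y => h1 y)
  · exact fun p => Or.inr (isAntiHolAt_of_pic_eqOn_discRot_conj e he hes hca ha h p)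

/-- **RC-holomorphic in both directions ⇒ isometry picture.**  By constancy of type on the
connected `Y`, `ψ` is biholomorphic (then its picture is a Möbius map) or anti-holomorphic everywhere
together with its inverse (then `pic ψ ∘ conj` is a holomorphic automorphism of the disc, so the
picture is anti-Möbius); both preserve `discCosh`. [cite: MochizukiAbsTopIII2015, Proposition 2.2 (ii) p.52] -/
theorem discCosh_pic_of_isRCHolomorphic (e : Y ≃ₜ unitDiscOpens)
    (he : MDifferentiable 𝓘(ℂ, ℂ) 𝓘(ℂ, ℂ) e) (hes : MDifferentiable 𝓘(ℂ, ℂ) 𝓘(ℂ, ℂ) e.symm) {ψ : Y ≃ₜ Y}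
    (h1 : IsRCHolomorphic (⇑ψ)) (h2 : IsRCHolomorphic (⇑ψ.symm)) :
    ∀ z ∈ ball (0 : ℂ) 1, ∀ w ∈ ball (0 : ℂ) 1,
      discCosh (Function.extend Subtype.val (Subtype.val ∘ (e.symm.trans (ψ.trans e))) (fun _ => (0 : ℂ)) z)
        (Function.extend Subtype.val (Subtype.val ∘ (e.symm.trans (ψ.trans e))) (fun _ => (0 : ℂ)) w) =
      discCosh z w := by
  haveI : ConnectedSpace unitDiscOpens := connectedSpace_unitDiscOpens
  haveI : ConnectedSpace Y := e.symm.surjective.connectedSpace e.symm.continuous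
  set P := Function.extend Subtype.val (Subtype.val ∘ (e.symm.trans (ψ.trans e))) (fun _ => (0 : ℂ))
    with hP
  rcases forall_isHolAt_or_forall_isAntiHolAt ψ h1 isPreconnected_univ with hhol | hanti
  · -- biholomorphic case
    have hd : MDifferentiable 𝓘(ℂ, ℂ) 𝓘(ℂ, ℂ) ψ := fun y => (hhol y trivial).self_of_nhds
    have hds : MDifferentiable 𝓘(ℂ, ℂ) 𝓘(ℂ, ℂ) ψ.symm := by
      intro q
      have := isHolAt_symm_of_isHolAt ψ (hhol (ψ.symm q) trivial) (h2 _)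
      rw [ψ.apply_symm_apply] at this
      exact this.self_of_nhds
    intro z hz w hw
    exact (isDiscAut_pic e he hes hd hds).discCosh_eq (mem_ball_zero_iff.1 hz) (mem_ball_zero_iff.1 hw)
  · -- anti-holomorphic case: `ψ⁻¹` is anti-holomorphic everywhere as well
    have hanti' : ∀ q, IsAntiHolAt (⇑ψ.symm) q := by
      intro q
      have := isAntiHolAt_symm_of_isAntiHolAt ψ (hanti (ψ.symm q) trivial) (h2 _)
        (by rw [Homeomorph.symm_symm]; exact h1 _)
      rw [ψ.apply_symm_apply] at this
      exact this
    have hD := differentiableOn_conj_pic e he hes fun p => hanti p trivial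
    have hD' := differentiableOn_conj_pic e he hes (ψ := ψ⁻¹) hanti'
    set P' := Function.extend Subtype.val (Subtype.val ∘ (e.symm.trans (ψ⁻¹.trans e))) (fun _ => (0 : ℂ))
      with hP'
    -- `g := P ∘ conj` is a holomorphic automorphism of the disc with inverse `conj ∘ P'`
    have hg : IsDiscAut (fun z => P (conj z)) := by
      refine IsDiscAut.mk' (g := conj ∘ P') ?_ ?_ ?_ ?_ ?_ ?_
      · intro z hz
        have : DifferentiableAt ℂ (conj ∘ (conj ∘ P) ∘ conj) z := by
          rw [differentiableAt_conj_conj_iff]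
          exact hD.differentiableAt (isOpen_ball.mem_nhds (conj_mem_unitBall hz))
        have heq : (conj ∘ (conj ∘ P) ∘ conj) = fun z => P (conj z) := by
          funext z; simp
        rw [heq] at this
        exact this.differentiableWithinAt
      · exact fun z hz => mapsTo_extend _ (conj_mem_unitBall hz)
      · exact hD'
      · exact fun z hz => conj_mem_unitBall (mapsTo_extend _ hz)
      · intro z hz
        simp only [comp_apply, hP, hP']
        rw [pic_inv_apply e ψ (conj_mem_unitBall hz), Complex.conj_conj]
      · intro z hz
        simp only [comp_apply, hP, hP', Complex.conj_conj]
        exact pic_apply_inv e ψ hz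
    obtain ⟨c, a, hca, ha, -, hge⟩ := hg.exists_eq_discRot
    intro z hz w hw
    have ez : P z = discRot c a (conj z) := by
      have := hge (conj_mem_unitBall hz); simp only [Complex.conj_conj] at this; exact this
    have ew : P w = discRot c a (conj w) := by
      have := hge (conj_mem_unitBall hw); simp only [Complex.conj_conj] at this; exact this
    rw [ez, ew]
    exact discCosh_discRot_conj hca ha (mem_ball_zero_iff.1 hz) (mem_ball_zero_iff.1 hw)

end RC

/-! ### Divisible generators -/

section Generators

variable {Y : Type} [TopologicalSpace Y] [ChartedSpace ℂ Y]

/-- Iterates of maps agreeing on the ball and preserving it agree on the ball. [folklore] -/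
private theorem eqOn_iterate_ball {F G : ℂ → ℂ} (h : EqOn F G (ball 0 1)) (hG : MapsTo G (ball 0 1) (ball 0 1))
    (n : ℕ) : EqOn F^[n] G^[n] (ball 0 1) := by
  induction n with
  | zero => intro z _; rfl
  | succ n ih =>
    intro z hz
    rw [Function.iterate_succ_apply, Function.iterate_succ_apply, h hz]
    exact ih (hG hz)

/-- **Divisibility transfer**: if the picture of `ρ` agrees on the ball with a map all of whose
"roots" are holomorphic automorphisms of the disc, then `ρ` has biholomorphic `n`-th roots in
`Y ≃ₜ Y` for every `n ≠ 0`. [cite: MochizukiAbsTopIII2015, Proposition 2.2 (ii) p.52] -/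
theorem exists_pow_eq_of_pic (e : Y ≃ₜ unitDiscOpens) (he : MDifferentiable 𝓘(ℂ, ℂ) 𝓘(ℂ, ℂ) e)
    (hes : MDifferentiable 𝓘(ℂ, ℂ) 𝓘(ℂ, ℂ) e.symm) {ρ : Y ≃ₜ Y} {F : ℂ → ℂ}
    (hρ : EqOn (Function.extend Subtype.val (Subtype.val ∘ (e.symm.trans (ρ.trans e))) (fun _ => (0 : ℂ)))
      F (ball 0 1))
    {n : ℕ} {R : ℂ → ℂ} (hR : IsDiscAut R) (hRn : ∀ z ∈ ball (0 : ℂ) 1, R^[n] z = F z) :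
    ∃ r : Y ≃ₜ Y, (MDifferentiable 𝓘(ℂ, ℂ) 𝓘(ℂ, ℂ) r ∧ MDifferentiable 𝓘(ℂ, ℂ) 𝓘(ℂ, ℂ) r.symm) ∧
      r ^ n = ρ := by
  obtain ⟨r, hr, hrs, hre⟩ := exists_homeomorph_of_isDiscAut e he hes hR
  refine ⟨r, ⟨hr, hrs⟩, eq_of_pic_eqOn e fun z hz => ?_⟩
  rw [pic_pow e r n hz, eqOn_iterate_ball hre hR.mapsTo n hz, hRn z hz, hρ hz]

/-- **Every biholomorphic self-homeomorphism is a product of three infinitely divisible ones**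
(a rotation and two half-turns in the disc picture: `c·φ_a = R_c ∘ σ_q ∘ σ_0`).
[cite: MochizukiAbsTopIII2015, Proposition 2.2 (ii) p.52] -/
theorem exists_eq_mul_mul_divisible (e : Y ≃ₜ unitDiscOpens) (he : MDifferentiable 𝓘(ℂ, ℂ) 𝓘(ℂ, ℂ) e)
    (hes : MDifferentiable 𝓘(ℂ, ℂ) 𝓘(ℂ, ℂ) e.symm) {f : Y ≃ₜ Y}
    (hf : MDifferentiable 𝓘(ℂ, ℂ) 𝓘(ℂ, ℂ) f) (hfs : MDifferentiable 𝓘(ℂ, ℂ) 𝓘(ℂ, ℂ) f.symm) :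
    ∃ ρ₁ ρ₂ ρ₃ : Y ≃ₜ Y, f = ρ₁ * ρ₂ * ρ₃ ∧
      ∀ ρ ∈ ({ρ₁, ρ₂, ρ₃} : Set (Y ≃ₜ Y)), ∀ n : ℕ, n ≠ 0 →
        ∃ r : Y ≃ₜ Y, (MDifferentiable 𝓘(ℂ, ℂ) 𝓘(ℂ, ℂ) r ∧ MDifferentiable 𝓘(ℂ, ℂ) 𝓘(ℂ, ℂ) r.symm) ∧
          r ^ n = ρ := by
  obtain ⟨c, a, hc, ha, -, hfe⟩ := (isDiscAut_pic e he hes hf hfs).exists_eq_discRot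
  obtain ⟨q, hq, hdec⟩ := discRot_eqOn_mul_halfTurn_halfTurn (c := c) ha
  obtain ⟨ρ₁, h1, h1s, h1e⟩ := exists_homeomorph_of_isDiscAut e he hes (isDiscAut_mul hc)
  obtain ⟨ρ₂, h2, h2s, h2e⟩ := exists_homeomorph_of_isDiscAut e he hes (isDiscAut_discHalfTurn hq)
  obtain ⟨ρ₃, h3, h3s, h3e⟩ := exists_homeomorph_of_isDiscAut e he hes
    (isDiscAut_discHalfTurn (q := 0) (by simp))
  refine ⟨ρ₁, ρ₂, ρ₃, eq_of_pic_eqOn e fun z hz => ?_, ?_⟩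
  · have hz₃ : discHalfTurn 0 z ∈ ball (0 : ℂ) 1 := (isDiscAut_discHalfTurn (q := 0) (by simp)).mapsTo hz
    have hz₂₃ : discHalfTurn q (discHalfTurn 0 z) ∈ ball (0 : ℂ) 1 := (isDiscAut_discHalfTurn hq).mapsTo hz₃
    have e1 := h1e hz₂₃
    simp only at e1
    rw [hfe hz, hdec hz, pic_mul e _ _ hz, h3e hz, pic_mul e _ _ hz₃, h2e hz₃, e1]
    rfl
  · intro ρ hρ n hn
    simp only [mem_insert_iff, mem_singleton_iff] at hρ
    rcases hρ with rfl | rfl | rfl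
    · obtain ⟨d, hd, hdn⟩ := exists_root_rotation hc hn
      exact exists_pow_eq_of_pic e he hes h1e (isDiscAut_mul hd) fun z _ => hdn z
    · obtain ⟨R, hR, hRn⟩ := exists_root_discHalfTurn hq hn
      exact exists_pow_eq_of_pic e he hes h2e hR hRn
    · obtain ⟨R, hR, hRn⟩ := exists_root_discHalfTurn (q := 0) (by simp) hn
      exact exists_pow_eq_of_pic e he hes h3e hR hRn

end Generators

end Literature.AnabelianGeometry.AbsoluteAnabelian
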